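import Mathlib
import HarnessLib
import Summits.RiemannHypothesis.RiemannHypothesis.Theses.WeilParity
import Summits.RiemannHypothesis.RiemannHypothesis.Theorems.WeilParityEvenSectorWinsUpToLogThreeHalf
import Summits.RiemannHypothesis.RiemannHypothesis.Theorems.WeilParityParityGlue
import Summits.RiemannHypothesis.RiemannHypothesis.Theorems.WeilGroundStateGroundStateSimpleEvenStubZeroSideLever
import Summits.RiemannHypothesis.RiemannHypothesis.Theorems.WeilGroundStateGroundStateSimpleEvenStubTransfer
import Literature.NumberTheory.LFunctions.WeilGroundStateRealZerosProofs
import Literature.NumberTheory.LFunctions.ZetaFirstZeroCertificate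

/-!
# Route WeilParity — crux `EvenWinsBeyondArch` (stmt-RiemannHypothesis-15432), line `Sketch`
# (two-scale creation ladder): the first lemma, its RH-free core, and `RH → K1 → crux`

Support file (`--supports stmt-RiemannHypothesis-15432`) for the line `Sketch` of crux-ideate round 1,
ideator 1 (card `Cruxes/EvenWinsBeyondArch/Ideas/two-scale-creation-ladder.md`).  Normalisation of
`Literature/NumberTheory/LFunctions/WeilExplicit.lean`: `Q = weilQuadratic`, window tests `IsWeilTest g`,
`tsupport g ⊆ [-a, a]`; sector bottoms `ε_ev(a) = weilEvenGroundEnergy a`, `ε_od(a) = weilOddGroundEnergy a`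
(Bombieri's `μ⁺(e^a)`, `μ⁻(e^a)`, `WeilGroundEnergyParitySplit.lean`).

## The mechanism (division lever + odd centrality)

For an odd window test `o` let `v(t) = ∫_{-a}^t o` be its window primitive: an EVEN window test with
`v' = o` (`exists_even_windowPrimitive`; `∫ o = 0` because `o` is odd).  Three inputs at the window `a`:

* (L) the FIRST-GAP LEVER on even window tests, `Λ · Re Q(v) ≤ Re Q(v')`;
* (P) even-sector nonnegativity `0 ≤ ε_ev(a)`;
* (C) ODD CENTRALITY of near-minimisers (the card's `OddCentralityAt a`, constant `Λ`): for every `δ > 0`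
  an odd normalised window test `o` with `Re Q(o) ≤ ε_od(a) + δ` and `1 ≤ Λ ∫ |∫_{-a}^t o|²`
  (the near-minimiser is slow: `‖o‖² ≤ Λ ‖∫o‖²`).

Then `ε_ev(a) ≤ ε_od(a)` by the single chain (homogeneous bound `ε_ev ∫|v|² ≤ Re Q(v)`)

`ε_ev ≤ (Λ ∫|v|²) ε_ev ≤ Λ Re Q(v) ≤ Re Q(o) ≤ ε_od + δ`

(`weilEvenGroundEnergy_le_weilOddGroundEnergy_of_lever_of_central`, RH-free; variant with (P) replaced by
`0 ≤ ε_od(a)`).  Under the Riemann hypothesis (L) holds with `Λ = 14² = 196` on ALL test functions (landed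
zero-side lever `stub_re_weilQuadratic_deriv_ge`, p96651, fed with the zero-free height `14`:
`riemannZeta_ne_zero_of_im_pos_of_im_le_fourteen`, kernel-checked `N(14) = 0`) and (P) holds at
every window (`WeilPositivity.of_riemannHypothesis explicit_formula_holds`), so:

* `weilEvenGroundEnergy_le_weilOddGroundEnergy_of_riemannHypothesis_of_central` — the card's FIRST LEMMA P1
  (`RH → OddCentralityAt a → ε_ev(a) ≤ ε_od(a)`; the card's `log 3/2 < a` is not needed);
* `evenWinsBeyondArch_of_riemannHypothesis_of_centralBeyond` — P2: `RH → (∀ a > log 3/2, OddCentralityAt a) →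
  EvenWinsBeyondArch`, the windows `a ≤ (log 3)/2` being the landed RH-free order
  (`WeilParity.weilEvenGroundEnergy_le_weilOddGroundEnergy_of_le_logThreeHalf`, p155433) and ORDER ⇒ crux the
  landed `evenWinsBeyondArch_of_forall_le` (p148526).

What this is NOT: an unconditional decomposition of the crux.  RH-free, (L) on all large windows is census S3
(indefinite phase off the line), (P) on all large windows is even-sector Weil positivity (RH-strength, Yoshida
1992 Prop. 1), and (C) = K1 is RH-strength by the card's own label — census D2.  The theorems here are the
line's provable content: the calibration direction `RH ∧ K1 → crux` with K1's two companions DISCHARGED under RH,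
so that `RHImpliesEvenWins` (item stmt-RiemannHypothesis-15436) is reduced to the RH-conditional analysis
statement `TwoScaleCentrality := RH → ∀ a > log 3/2, OddCentralityAt a` (sibling file).

Mathlib + landed tree files only; no definitions (centrality is spelled inline), no named facts, RH only as an
explicit hypothesis.

References: E. Bombieri, Rend. Lincei (9) 11 (2000) §4 Problem 2, Thm. 5 (sector bottoms, homogeneity);
A. Connes, letter 2026 §6.4 and Connes–Consani–Moscovici arXiv:2511.22755 §7 (even bottom, prolate picture);
the card's numerics kit j025381 (`ω_od = ‖o₀‖/‖∫o₀‖ = 4.75 → 3.26` on `a ∈ [0.35, 1.4]`, i.e. (C) with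
`Λ = 196` holds numerically with slack `(14/ω)² = 8.9 → 18.8`).
-/

-- single-conjunct summit: the mandated namespace repeats a component (D-0017)
set_option linter.dupNamespace false

noncomputable section

namespace Summit.RiemannHypothesis.RiemannHypothesis.Theorems.EvenWinsBeyondArch.TwoScale

open MeasureTheory Set Filter
open scoped Real Topology ComplexConjugate
open Literature.NumberTheory.LFunctions
open Summit.RiemannHypothesis.RiemannHypothesis.Theses.WeilParity

/-! ## The even window primitive of an odd window test -/

/-- An odd function has integral zero over every symmetric interval. [folklore] -/
theorem intervalIntegral_symm_eq_zero_of_odd {o : ℝ → ℂ} (hodd : ∀ t, o (-t) = -o t) (a : ℝ) :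
    ∫ s in (-a)..a, o s = 0 := by
  have h1 : ∫ s in (-a)..a, o (-s) = ∫ s in (-a)..a, o s := by
    rw [intervalIntegral.integral_comp_neg, neg_neg]
  have h2 : ∫ s in (-a)..a, o (-s) = -∫ s in (-a)..a, o s := by
    simp_rw [hodd]
    exact intervalIntegral.integral_neg
  linear_combination (h1.symm.trans h2) / 2

/-- **The window primitive of an odd function is even**: for `o` integrable and odd,
`∫_{-a}^{-t} o = ∫_{-a}^{t} o` (`∫_{-a}^{-t} o = ∫_t^a o(-·) = −∫_t^a o = ∫_{-a}^t o − ∫_{-a}^a o` and the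
last integral vanishes). [folklore] -/
theorem primitive_neg_of_odd {o : ℝ → ℂ} (hoi : Integrable o) (hodd : ∀ t, o (-t) = -o t) (a t : ℝ) :
    ∫ s in (-a)..(-t), o s = ∫ s in (-a)..t, o s := by
  have h1 : ∫ s in (-a)..(-t), o s = ∫ s in t..a, o (-s) :=
    (intervalIntegral.integral_comp_neg o).symm
  have h2 : ∫ s in t..a, o (-s) = -∫ s in t..a, o s := by
    simp_rw [hodd]
    exact intervalIntegral.integral_neg
  have h3 : (∫ s in (-a)..t, o s) + ∫ s in t..a, o s = ∫ s in (-a)..a, o s :=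
    intervalIntegral.integral_add_adjacent_intervals hoi.intervalIntegrable hoi.intervalIntegrable
  have h0 := intervalIntegral_symm_eq_zero_of_odd hodd a
  rw [h1, h2]
  linear_combination -h0 - h3

/-- **The even window primitive of an odd window test.** An odd test function `o` on the window
`[-a, a]` is the derivative of an EVEN test function `v` on the same window, `v(t) = ∫_{-a}^t o`
(`ConnesVanSuijlekom.exists_primitive` at `w = 0`, applicable since `∫ o = 0`,
`Theorems.integral_eq_zero_of_odd`; evenness by
`primitive_neg_of_odd`).  On the transform side `v̂(½ + ix) = i ô(½ + ix)/x`: the division lever.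
[folklore] -/
theorem exists_even_windowPrimitive {a : ℝ} {o : ℝ → ℂ} (ho : IsWeilTest o)
    (hos : tsupport o ⊆ Icc (-a) a) (hodd : ∀ t, o (-t) = -o t) :
    ∃ v : ℝ → ℂ, IsWeilTest v ∧ tsupport v ⊆ Icc (-a) a ∧ (∀ t, v (-t) = v t) ∧ deriv v = o ∧
      ∀ t, v t = ∫ s in (-a)..t, o s := by
  obtain ⟨v, hv, hvs, hd, hv'⟩ :=
    ConnesVanSuijlekom.exists_primitive ho hos 0 (by simpa using integral_eq_zero_of_odd hodd)
  have hvi : ∀ t, v t = ∫ s in (-a)..t, o s := fun t ↦ by simpa using hv' t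
  have hoi : Integrable o := ho.1.continuous.integrable_of_hasCompactSupport ho.2
  refine ⟨v, hv, hvs, fun t ↦ ?_, funext fun t ↦ by simpa using hd t, hvi⟩
  rw [hvi, hvi]
  exact primitive_neg_of_odd hoi hodd a t

/-! ## The RH-free core: lever + nonnegativity + odd centrality ⇒ order -/

/-- **ORDER FROM THE DIVISION LEVER AND ODD CENTRALITY (RH-free core of the card's first lemma).**
At a window `a`, assume (L) the first-gap lever `Λ Re Q(v) ≤ Re Q(v')` for even window tests `v`,
(P) `0 ≤ ε_ev(a)`, and (C) odd near-minimisers may be chosen central with constant `Λ`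
(`Re Q(o) ≤ ε_od(a) + δ`, `1 ≤ Λ ∫|∫_{-a}^t o|²`).  Then `ε_ev(a) ≤ ε_od(a)`:
with `v` the even window primitive of `o`,
`ε_ev ≤ (Λ∫|v|²) ε_ev ≤ Λ Re Q(v) ≤ Re Q(v') = Re Q(o) ≤ ε_od + δ` for every `δ > 0`
(homogeneous bound `weilEvenGroundEnergy_mul_le_re`). [folklore] -/
theorem weilEvenGroundEnergy_le_weilOddGroundEnergy_of_lever_of_central {a Λ : ℝ}
    (hlever : ∀ v : ℝ → ℂ, IsWeilTest v → tsupport v ⊆ Icc (-a) a → (∀ t, v (-t) = v t) →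
      Λ * (weilQuadratic v).re ≤ (weilQuadratic (deriv v)).re)
    (hnn : 0 ≤ weilEvenGroundEnergy a)
    (hc : ∀ δ : ℝ, 0 < δ → ∃ o : ℝ → ℂ, IsWeilTest o ∧ tsupport o ⊆ Icc (-a) a ∧
      (∀ t, o (-t) = -o t) ∧ ∫ t, ‖o t‖ ^ 2 = (1 : ℝ) ∧
      (weilQuadratic o).re ≤ weilOddGroundEnergy a + δ ∧
      (1 : ℝ) ≤ Λ * ∫ t, ‖∫ s in (-a)..t, o s‖ ^ 2) :
    weilEvenGroundEnergy a ≤ weilOddGroundEnergy a := by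
  refine le_of_forall_pos_le_add fun δ hδ ↦ ?_
  obtain ⟨o, ho, hos, hodd, -, hQo, hcen⟩ := hc δ hδ
  obtain ⟨v, hv, hvs, hev, hd, hvi⟩ := exists_even_windowPrimitive ho hos hodd
  -- `N = ∫|v|² = ∫|∫_{-a}^t o|²`, so `1 ≤ Λ N`
  set N : ℝ := ∫ t, ‖v t‖ ^ 2 with hN
  have hNeq : (∫ t, ‖∫ s in (-a)..t, o s‖ ^ 2) = N := by
    rw [hN]
    congr 1
    funext t
    rw [hvi t]
  rw [hNeq] at hcen
  have hN0 : 0 ≤ N := integral_nonneg fun _ ↦ by positivity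
  have hΛ : 0 ≤ Λ := by
    by_contra hneg
    push Not at hneg
    nlinarith [mul_nonpos_iff.2 (Or.inr ⟨hneg.le, hN0⟩)]
  -- the homogeneous bound and the lever (`v' = o`)
  have h1 : weilEvenGroundEnergy a * N ≤ (weilQuadratic v).re := weilEvenGroundEnergy_mul_le_re hv hvs hev
  have h2 : Λ * (weilQuadratic v).re ≤ (weilQuadratic o).re := by
    have h := hlever v hv hvs hev
    rwa [hd] at h
  calc weilEvenGroundEnergy a = weilEvenGroundEnergy a * 1 := (mul_one _).symm
    _ ≤ weilEvenGroundEnergy a * (Λ * N) := mul_le_mul_of_nonneg_left hcen hnn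
    _ = Λ * (weilEvenGroundEnergy a * N) := by ring
    _ ≤ Λ * (weilQuadratic v).re := mul_le_mul_of_nonneg_left h1 hΛ
    _ ≤ (weilQuadratic o).re := h2
    _ ≤ weilOddGroundEnergy a + δ := hQo

/-- **Variant**: the same with (P) replaced by odd-sector nonnegativity `0 ≤ ε_od(a)` (if `ε_ev(a) < 0` the
order is immediate, otherwise the core applies). [folklore] -/
theorem weilEvenGroundEnergy_le_weilOddGroundEnergy_of_lever_of_central' {a Λ : ℝ}
    (hlever : ∀ v : ℝ → ℂ, IsWeilTest v → tsupport v ⊆ Icc (-a) a → (∀ t, v (-t) = v t) →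
      Λ * (weilQuadratic v).re ≤ (weilQuadratic (deriv v)).re)
    (hnn : 0 ≤ weilOddGroundEnergy a)
    (hc : ∀ δ : ℝ, 0 < δ → ∃ o : ℝ → ℂ, IsWeilTest o ∧ tsupport o ⊆ Icc (-a) a ∧
      (∀ t, o (-t) = -o t) ∧ ∫ t, ‖o t‖ ^ 2 = (1 : ℝ) ∧
      (weilQuadratic o).re ≤ weilOddGroundEnergy a + δ ∧
      (1 : ℝ) ≤ Λ * ∫ t, ‖∫ s in (-a)..t, o s‖ ^ 2) :
    weilEvenGroundEnergy a ≤ weilOddGroundEnergy a := by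
  rcases le_or_gt 0 (weilEvenGroundEnergy a) with h | h
  · exact weilEvenGroundEnergy_le_weilOddGroundEnergy_of_lever_of_central hlever h hc
  · exact h.le.trans hnn

/-! ## Under RH: the lever with `Λ = 14² = 196`, the first lemma P1, and `RH → K1 → crux` (P2) -/

/-- **The first-gap lever under RH, `γ₁ = 14`**: `196 · Re Q(v) ≤ Re Q(v')` for every test function `v`
(landed zero-side lever `stub_re_weilQuadratic_deriv_ge`: on the critical line `(v')^(ρ) = −(ρ − ½) v̂(ρ)` and
`|ρ − ½|² = (Im ρ)² ≥ 14²`, the zero-free height `14` being the kernel-checked `N(14) = 0`,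
`riemannZeta_ne_zero_of_im_pos_of_im_le_fourteen`). [folklore] -/
theorem lever_of_riemannHypothesis (hRH : _root_.RiemannHypothesis) {v : ℝ → ℂ} (hv : IsWeilTest v) :
    196 * (weilQuadratic v).re ≤ (weilQuadratic (deriv v)).re := by
  have hfree : ∀ s : ℂ, riemannZeta s = 0 → 0 < s.im → (14 : ℝ) ≤ s.im := by
    intro s hs him
    by_contra hlt
    push Not at hlt
    exact riemannZeta_ne_zero_of_im_pos_of_im_le_fourteen him hlt.le hs
  have h := stub_re_weilQuadratic_deriv_ge hRH (by norm_num : (0 : ℝ) < 14) hfree hv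
  norm_num at h
  exact h

/-- **Even-sector nonnegativity under RH** at every window (`Re Q ≥ 0` on all tests, the easy half of
Weil's criterion `WeilPositivity.of_riemannHypothesis` with the discharged explicit formula). [folklore] -/
theorem weilEvenGroundEnergy_nonneg_of_riemannHypothesis (hRH : _root_.RiemannHypothesis) (a : ℝ) :
    0 ≤ weilEvenGroundEnergy a :=
  (weilEvenGroundEnergy_nonneg_iff a).2 fun g hg _ _ ↦
    WeilPositivity.of_riemannHypothesis explicit_formula_holds hRH g hg

/-- **THE CARD'S FIRST LEMMA (P1).** Under the Riemann hypothesis, at any window `a`, ODD CENTRALITY of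
near-minimisers with constant `196 = 14²` (`OddCentralityAt a` of the card: for every `δ > 0` an odd
normalised window test `o` with `Re Q(o) ≤ ε_od(a) + δ` and `1 ≤ 196 ∫ |∫_{-a}^t o|²`) implies the parity
order `ε_ev(a) ≤ ε_od(a)` (core lemma with the RH lever and RH nonnegativity; the card's hypothesis
`(log 3)/2 < a` is not used). [folklore] -/
theorem weilEvenGroundEnergy_le_weilOddGroundEnergy_of_riemannHypothesis_of_central
    (hRH : _root_.RiemannHypothesis) {a : ℝ}
    (hc : ∀ δ : ℝ, 0 < δ → ∃ o : ℝ → ℂ, IsWeilTest o ∧ tsupport o ⊆ Icc (-a) a ∧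
      (∀ t, o (-t) = -o t) ∧ ∫ t, ‖o t‖ ^ 2 = (1 : ℝ) ∧
      (weilQuadratic o).re ≤ weilOddGroundEnergy a + δ ∧
      (1 : ℝ) ≤ 196 * ∫ t, ‖∫ s in (-a)..t, o s‖ ^ 2) :
    weilEvenGroundEnergy a ≤ weilOddGroundEnergy a :=
  weilEvenGroundEnergy_le_weilOddGroundEnergy_of_lever_of_central
    (fun _ hv _ _ ↦ lever_of_riemannHypothesis hRH hv) (weilEvenGroundEnergy_nonneg_of_riemannHypothesis hRH a)
    hc

/-- **P2: `RH → K1 → EvenWinsBeyondArch`.** Under the Riemann hypothesis, odd centrality beyond the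
one-prime window (`K1 = OddCentralityBeyond := ∀ a > (log 3)/2, OddCentralityAt a`, the card's RH-strength
stub) implies the crux: order on `a ≤ (log 3)/2` is the landed RH-free theorem
`WeilParity.weilEvenGroundEnergy_le_weilOddGroundEnergy_of_le_logThreeHalf` (archimedean + one-prime windows),
beyond it P1, and ORDER ⇒ crux is `evenWinsBeyondArch_of_forall_le`. [folklore] -/
theorem evenWinsBeyondArch_of_riemannHypothesis_of_centralBeyond (hRH : _root_.RiemannHypothesis)
    (hK1 : ∀ a : ℝ, Real.log 3 / 2 < a → ∀ δ : ℝ, 0 < δ → ∃ o : ℝ → ℂ, IsWeilTest o ∧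
      tsupport o ⊆ Icc (-a) a ∧ (∀ t, o (-t) = -o t) ∧ ∫ t, ‖o t‖ ^ 2 = (1 : ℝ) ∧
      (weilQuadratic o).re ≤ weilOddGroundEnergy a + δ ∧
      (1 : ℝ) ≤ 196 * ∫ t, ‖∫ s in (-a)..t, o s‖ ^ 2) :
    EvenWinsBeyondArch :=
  evenWinsBeyondArch_of_forall_le fun a ha ↦ by
    rcases le_or_gt a (Real.log 3 / 2) with h3 | h3
    · exact WeilParity.weilEvenGroundEnergy_le_weilOddGroundEnergy_of_le_logThreeHalf
        (log_two_half_pos.trans ha) h3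
    · exact weilEvenGroundEnergy_le_weilOddGroundEnergy_of_riemannHypothesis_of_central hRH (hK1 a h3)

/-- **RH-free form of the line's composition (census D2, typed): the crux from the three window-wise inputs
beyond the one-prime window** — lever (L) with constant `Λ`, even nonnegativity (P), odd centrality (C) with the
same `Λ` — recorded so that the RH-dependence of the line is explicit: under RH, (L) (`Λ = 196`) and (P) are the two
theorems above and (C) is the card's K1. [folklore] -/
theorem evenWinsBeyondArch_of_lever_of_nonneg_of_centralBeyond {Λ : ℝ}
    (hL : ∀ a : ℝ, Real.log 3 / 2 < a → ∀ v : ℝ → ℂ, IsWeilTest v → tsupport v ⊆ Icc (-a) a →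
      (∀ t, v (-t) = v t) → Λ * (weilQuadratic v).re ≤ (weilQuadratic (deriv v)).re)
    (hP : ∀ a : ℝ, Real.log 3 / 2 < a → 0 ≤ weilEvenGroundEnergy a)
    (hC : ∀ a : ℝ, Real.log 3 / 2 < a → ∀ δ : ℝ, 0 < δ → ∃ o : ℝ → ℂ, IsWeilTest o ∧
      tsupport o ⊆ Icc (-a) a ∧ (∀ t, o (-t) = -o t) ∧ ∫ t, ‖o t‖ ^ 2 = (1 : ℝ) ∧
      (weilQuadratic o).re ≤ weilOddGroundEnergy a + δ ∧
      (1 : ℝ) ≤ Λ * ∫ t, ‖∫ s in (-a)..t, o s‖ ^ 2) :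
    EvenWinsBeyondArch :=
  evenWinsBeyondArch_of_forall_le fun a ha ↦ by
    rcases le_or_gt a (Real.log 3 / 2) with h3 | h3
    · exact WeilParity.weilEvenGroundEnergy_le_weilOddGroundEnergy_of_le_logThreeHalf
        (log_two_half_pos.trans ha) h3
    · exact weilEvenGroundEnergy_le_weilOddGroundEnergy_of_lever_of_central (hL a h3) (hP a h3) (hC a h3)

/-! ## Calibration: `RHImpliesEvenWins` (item stmt-RiemannHypothesis-15436) from `TwoScaleCentrality` -/

/-- **The route thesis under RH from K1**: `RH → OddCentralityBeyond → EvenSectorWins` (P2 with the landed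
archimedean range `evenWinsArch_proof` and the landed glue `parityGlue_proof`). [folklore] -/
theorem evenSectorWins_of_riemannHypothesis_of_centralBeyond (hRH : _root_.RiemannHypothesis)
    (hK1 : ∀ a : ℝ, Real.log 3 / 2 < a → ∀ δ : ℝ, 0 < δ → ∃ o : ℝ → ℂ, IsWeilTest o ∧
      tsupport o ⊆ Icc (-a) a ∧ (∀ t, o (-t) = -o t) ∧ ∫ t, ‖o t‖ ^ 2 = (1 : ℝ) ∧
      (weilQuadratic o).re ≤ weilOddGroundEnergy a + δ ∧
      (1 : ℝ) ≤ 196 * ∫ t, ‖∫ s in (-a)..t, o s‖ ^ 2) :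
    EvenSectorWins :=
  WeilParity.parityGlue_proof WeilParity.evenWinsArch_proof
    (evenWinsBeyondArch_of_riemannHypothesis_of_centralBeyond hRH hK1)

/-- **CALIBRATION REDUCTION.** The card's RH-conditional analysis target
`TwoScaleCentrality := RH → ∀ a > (log 3)/2, OddCentralityAt a` (K2) implies the route's calibration item
`RHImpliesEvenWins` (stmt-RiemannHypothesis-15436: `RH → EvenSectorWins`): with RH in hand, K2 supplies K1 and
`evenSectorWins_of_riemannHypothesis_of_centralBeyond` applies.  This is where the line `Sketch` lives
logically: it reduces "X is not stronger than RH" to a second-moment statement about odd near-minimisers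
under RH. [folklore] -/
theorem rhImpliesEvenWins_of_twoScaleCentrality
    (hK2 : _root_.RiemannHypothesis → ∀ a : ℝ, Real.log 3 / 2 < a → ∀ δ : ℝ, 0 < δ → ∃ o : ℝ → ℂ,
      IsWeilTest o ∧ tsupport o ⊆ Icc (-a) a ∧ (∀ t, o (-t) = -o t) ∧ ∫ t, ‖o t‖ ^ 2 = (1 : ℝ) ∧
      (weilQuadratic o).re ≤ weilOddGroundEnergy a + δ ∧
      (1 : ℝ) ≤ 196 * ∫ t, ‖∫ s in (-a)..t, o s‖ ^ 2) :
    RHImpliesEvenWins :=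
  fun hRH ↦ evenSectorWins_of_riemannHypothesis_of_centralBeyond hRH (hK2 hRH)

end Summit.RiemannHypothesis.RiemannHypothesis.Theorems.EvenWinsBeyondArch.TwoScale

/-! ## Registered sub-goals of the crux item (verbatim uncurried signatures) -/

namespace Summit.RiemannHypothesis.RiemannHypothesis.Theorems

open MeasureTheory Set
open Literature.NumberTheory.LFunctions

/-- **Registered sub-goal `stub_orderOfRHOfOddCentral` of stmt-RiemannHypothesis-15432 (line `Sketch`): the
card's first lemma P1, uncurried** — under RH, odd centrality of near-minimisers at a window (constant
`196 = 14²`) gives the parity order `ε_ev(a) ≤ ε_od(a)`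
(`EvenWinsBeyondArch.TwoScale.weilEvenGroundEnergy_le_weilOddGroundEnergy_of_riemannHypothesis_of_central`).
[folklore] -/
theorem stub_orderOfRHOfOddCentral :
    RiemannHypothesis → ∀ a : ℝ, (∀ δ : ℝ, 0 < δ → ∃ o : ℝ → ℂ,
      Literature.NumberTheory.LFunctions.IsWeilTest o ∧ tsupport o ⊆ Set.Icc (-a) a ∧
      (∀ t, o (-t) = -o t) ∧ ∫ t, ‖o t‖ ^ 2 = (1 : ℝ) ∧
      (Literature.NumberTheory.LFunctions.weilQuadratic o).re ≤
        Literature.NumberTheory.LFunctions.weilOddGroundEnergy a + δ ∧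
      (1 : ℝ) ≤ 196 * ∫ t, ‖∫ s in (-a)..t, o s‖ ^ 2) →
      Literature.NumberTheory.LFunctions.weilEvenGroundEnergy a ≤
        Literature.NumberTheory.LFunctions.weilOddGroundEnergy a :=
  fun hRH _ hc =>
    EvenWinsBeyondArch.TwoScale.weilEvenGroundEnergy_le_weilOddGroundEnergy_of_riemannHypothesis_of_central
      hRH hc

/-- **Registered sub-goal `stub_evenWinsBeyondArchOfRHOfOddCentralBeyond` of stmt-RiemannHypothesis-15432 (line
`Sketch`): P2, uncurried** — under RH, odd centrality beyond the one-prime window (the card's K1, constant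
`196`) gives the crux `EvenWinsBeyondArch`
(`EvenWinsBeyondArch.TwoScale.evenWinsBeyondArch_of_riemannHypothesis_of_centralBeyond`). [folklore] -/
theorem stub_evenWinsBeyondArchOfRHOfOddCentralBeyond :
    RiemannHypothesis → (∀ a : ℝ, Real.log 3 / 2 < a → ∀ δ : ℝ, 0 < δ → ∃ o : ℝ → ℂ,
      Literature.NumberTheory.LFunctions.IsWeilTest o ∧ tsupport o ⊆ Set.Icc (-a) a ∧
      (∀ t, o (-t) = -o t) ∧ ∫ t, ‖o t‖ ^ 2 = (1 : ℝ) ∧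
      (Literature.NumberTheory.LFunctions.weilQuadratic o).re ≤
        Literature.NumberTheory.LFunctions.weilOddGroundEnergy a + δ ∧
      (1 : ℝ) ≤ 196 * ∫ t, ‖∫ s in (-a)..t, o s‖ ^ 2) →
      Summit.RiemannHypothesis.RiemannHypothesis.Theses.WeilParity.EvenWinsBeyondArch :=
  fun hRH hK1 =>
    EvenWinsBeyondArch.TwoScale.evenWinsBeyondArch_of_riemannHypothesis_of_centralBeyond hRH hK1

/-- **Registered sub-goal `stub_rhImpliesEvenWinsOfTwoScaleCentrality` of stmt-RiemannHypothesis-15432 (line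
`Sketch`): the calibration reduction, uncurried** — the card's K2 (`TwoScaleCentrality`, RH-conditional odd
centrality beyond the one-prime window, constant `196`) implies the route item `RHImpliesEvenWins`
(`EvenWinsBeyondArch.TwoScale.rhImpliesEvenWins_of_twoScaleCentrality`). [folklore] -/
theorem stub_rhImpliesEvenWinsOfTwoScaleCentrality :
    (RiemannHypothesis → ∀ a : ℝ, Real.log 3 / 2 < a → ∀ δ : ℝ, 0 < δ → ∃ o : ℝ → ℂ,
      Literature.NumberTheory.LFunctions.IsWeilTest o ∧ tsupport o ⊆ Set.Icc (-a) a ∧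
      (∀ t, o (-t) = -o t) ∧ ∫ t, ‖o t‖ ^ 2 = (1 : ℝ) ∧
      (Literature.NumberTheory.LFunctions.weilQuadratic o).re ≤
        Literature.NumberTheory.LFunctions.weilOddGroundEnergy a + δ ∧
      (1 : ℝ) ≤ 196 * ∫ t, ‖∫ s in (-a)..t, o s‖ ^ 2) →
      Summit.RiemannHypothesis.RiemannHypothesis.Theses.WeilParity.RHImpliesEvenWins :=
  fun hK2 => EvenWinsBeyondArch.TwoScale.rhImpliesEvenWins_of_twoScaleCentrality hK2

end Summit.RiemannHypothesis.RiemannHypothesis.Theorems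

end
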